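import Summits.BirchSwinnertonDyer.Rank1Residual.X10.ResidualSelmerLocalRamification
import HarnessLib

/-!
# The `E[p]` instance of the N2 parity law, PART X′: LOCAL RAMIFICATION of a Kummer class at a
# split `I_n` place with `p ∣ n` — `κ_v(P) ∈ H¹_ur(K_v, E[p]) ↔ (n/p) • P ∈ E₀(K_v)`
# (cell `b2b-bsdres`, unit `b2b-bsdres-x10` = N2 class lead, GEN 32; TOOL — one theorem, no
# definition, no named fact, nothing booked; generalises PART X (`ord_v Δ = p`) to `p ∣ ord_v Δ`)

HONEST FRAMING (run/shared/lean/b2b/bsd-rank1-residual/, verbatim in every file): the goal of the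
cell is to DELETE the COMBINATION-SHAPED residual classes of the Birch–Swinnerton-Dyer formula for
ALL analytic-rank `≤ 1` elliptic curves over `ℚ` — "full BSD formula for every rank `≤ 1` curve in
class `C`" assembled STRICTLY from published theorems — so that the rank-`≤ 1` remainder becomes
exactly the CONSTRUCTION-SHAPED classes, which are TYPED (missing-input `Prop`s), NOT attempted.
This is not "finishing BSD". Class X10b (= N2) keeps its label CONSTRUCTION-SHAPED (NEEDS `X_A3`,
referee R82.3 / RESIDUAL-MAP §I N2); this file is a TOOL; no mark / label / tier / count moves.

## What

PART X (`X10/ResidualSelmerLocalRamification.lean`) proved, at a split multiplicative place `v ∤ p`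
with `ord_v Δ_min = p`, that the local Kummer class `κ_v(P) ∈ H¹(K_v, E[p])` is unramified iff `P`
has nonsingular reduction on the local minimal integral model. Here the hypothesis is relaxed to
`p ∣ n := ord_v Δ_min` (`I_n`, component group `Φ_v ≅ ℤ/n`):
**`localKummerMap_mem_unramifiedSubgroup_iff_hasNonsingularReduction_nsmul`** —
`κ_v(P) ∈ H¹_ur ↔ ((n/p) • P)` has nonsingular reduction (i.e. the component of `P` lies in `pΦ_v`).
Proof = PART X's steps (1)–(5) verbatim (the explicit transport, `E₀' = g⁻¹(E₀)`, `E₀' ≤ A :=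
κ⁻¹(H¹_ur)`, `A ≠ ⊤` by the Kodaira–Néron witness), then: `B := E₀' ⊔ pE(K_v)` has index `p`
(`ResidualSelmerLocalTerm.index_eq_of_generator`, the rational generator of `E(K_v)/E₀' ≅ ℤ/n`),
`pE(K_v) ≤ A` (a `p`-multiple of a rational point has a Galois-fixed `p`-th root), so `A = B`; and
`Q ∈ B ↔ (n/p) • Q ∈ E₀'` by the arithmetic of `ℤ/n`. USE (x10 GEN ≥ 33): the (G) template of
`X10/ResidualSelmerGeneratorTestRecord118810j1.lean` at split `I₆` / `I₁₅` places (TRIVIAL-ROADS §9: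
partner `22090l1`, `I₆` at `2`, for the cells 22090n1, 154630n1, 242990d1, 242990f1, 340186p1,
472726e1; `354482d1`, `I₁₅` at `2`): `κ_2(P)` is ramified iff `2P` (resp. `5P`) reduces to the node.

References: [SilvermanAEC2009] VII.1 Prop. 1.3(b), VII.2, C.§15; [SilvermanATAEC1994] IV.9 Cor. 9.2(d);
[MazurRubin2007] proof of Thm. 1.4; HOME/X10-AUDIT.md §38.9.
-/

set_option autoImplicit false

noncomputable section

open scoped Classical NNReal

open Function NumberField IsDedekindDomain Field WeierstrassCurve IsLocalRing
  Literature.NumberTheory.EllipticCurves Literature.NumberTheory.GaloisRepresentations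
  IsDedekindDomain.HeightOneSpectrum
open Summit.BirchSwinnertonDyer.Rank1Residual.Additive
open Summit.BirchSwinnertonDyer.Rank1Residual.X10.ResidualSelmerLocalTerm
open Summit.BirchSwinnertonDyer.Rank1Residual.X10.ResidualSelmerLocalRamification

namespace Summit.BirchSwinnertonDyer.Rank1Residual.X10.ResidualSelmerLocalRamificationDiv

variable {K : Type} [Field K] [NumberField K]

/-- **`κ_v(P)` is unramified iff `(n/p) • P ∈ E₀(K_v)`, at a split multiplicative `v ∤ p` with
`p ∣ n = ord_v(Δ_min)`.** For an elliptic curve `E = W` over a number field `K`, a prime `p`, a finite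
place `v ∤ p` of split multiplicative reduction with `p ∣ ordMinimalDiscriminant v =: n`, a change of
variables `C` over `K_v` onto the local minimal model, and `P ∈ E(K_v)`: `κ_v(P) ∈ H¹(K_v, E[p])`
lies in the unramified subgroup iff `C • ((n/p) • P)` has nonsingular reduction on the local minimal
integral model (the component of `P` in `Φ_v ≅ ℤ/n` is divisible by `p`). No named fact.
[cite: MazurRubin2007, proof of Thm. 1.4] [cite: SilvermanAEC2009, VII.1 Prop. 1.3(b) and VII.2 Prop. 2.1]
[cite: SilvermanATAEC1994, Cor. IV.9.2(d) (PDF p. 340)] -/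
theorem localKummerMap_mem_unramifiedSubgroup_iff_hasNonsingularReduction_nsmul
    (W : WeierstrassCurve K) [W.IsElliptic] (v : HeightOneSpectrum (𝓞 K)) {p : ℕ} [hp : Fact p.Prime]
    (hpv : (p : 𝓞 K) ∉ v.asIdeal) (hsplit : W.HasSplitMultiplicativeReductionAt v)
    (hn : p ∣ W.ordMinimalDiscriminant v) {C : VariableChange (v.adicCompletion K)}
    (hC : C • W.baseChange (v.adicCompletion K) = W.localMinimalModel v)
    (hp0 : ((p : ℕ) : ℤ) ≠ 0) (P : (W.baseChange (v.adicCompletion K)).toAffine.Point) :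
    W.localKummerMap (v.adicCompletion K) hp0 P ∈
        DiscreteGaloisModule.unramifiedSubgroup
          ((W.torsionGaloisModule (p : ℤ)).restrictField (v.adicCompletion K)) 1 ↔
      (W.localMinimalIntegralModel v).HasNonsingularReduction
        (Affine.Point.congrEquiv (hC.trans (W.map_localMinimalIntegralModel_eq (v := v)).symm)
          (VariableChange.pointEquiv (W.baseChange (v.adicCompletion K)) C
            ((W.ordMinimalDiscriminant v / p) • P))) := by
  have hpp : p.Prime := hp.out
  haveI : CharZero (v.adicCompletion K) :=
    charZero_of_injective_algebraMap (algebraMap K (v.adicCompletion K)).injective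
  obtain ⟨w, hw⟩ := v.exists_spectralValuation
  obtain ⟨𝔐, h𝔐⟩ := v.localPrimesAbove_nonempty
  have hv0 : w.Integers w.integer := Valuation.integer.integers w
  have hvO := integers_valuationRing_valuation (v.adicCompletionIntegers K) (v.adicCompletion K)
  set U := DiscreteGaloisModule.unramifiedSubgroup
    ((W.torsionGaloisModule (p : ℤ)).restrictField (v.adicCompletion K)) 1 with hU
  set A : AddSubgroup (W.baseChange (v.adicCompletion K)).toAffine.Point :=
    U.comap (W.localKummerMap (v.adicCompletion K) hp0) with hA
  have hmemA : ∀ Q₀, Q₀ ∈ A ↔ ∃ Q : localPoints W (v.adicCompletion K),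
      (p : ℤ) • Q = W.baseChangeGeomPointsEquiv (v.adicCompletion K)
        (toGeomPoints (W.baseChange (v.adicCompletion K)) Q₀) ∧
        ∀ τ ∈ absInertia (v.adicCompletion K), τ • Q = Q := fun Q₀ => by
    rw [hA, AddSubgroup.mem_comap, hU, W.localKummerMap_mem_unramifiedSubgroup_iff hp0]
  /- (1) the local minimal integral model `I`, its Tate normal form `J = D • I` (`D` over `𝓞_v`),
  and `C' = D_K C` with `C' • E_{K_v} = J_{K_v}` -/
  set I := W.localMinimalIntegralModel v with hI
  have hCI : C • W.baseChange (v.adicCompletion K) = I.baseChange (v.adicCompletion K) :=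
    hC.trans (W.map_localMinimalIntegralModel_eq (v := v)).symm
  obtain ⟨ϖ, hϖ⟩ := IsDiscreteValuationRing.exists_irreducible (v.adicCompletionIntegers K)
  obtain ⟨D, α, hn1, hDI, hDX⟩ := W.exists_variableChange_localMinimalModel_eq_tateNormalForm v hsplit hϖ
  set n := W.ordMinimalDiscriminant v
  set J : WeierstrassCurve (v.adicCompletionIntegers K) := D • I with hJ
  have hJ1 : J.a₁ = 1 := by rw [hDI]
  have hJ2 : J.a₂ = 0 := by rw [hDI]
  have hJ3 : J.a₃ = 0 := by rw [hDI]
  have hJ4 : J.a₄ = 0 := by rw [hDI]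
  have hJ6' : J.a₆ = (α : v.adicCompletionIntegers K) * ϖ ^ n := by rw [hDI]
  have h6 : J.a₆ ∈ maximalIdeal (v.adicCompletionIntegers K) := by
    rw [hJ6']
    exact Ideal.mul_mem_left _ _ (Ideal.pow_mem_of_mem _
      ((IsLocalRing.mem_maximalIdeal _).mpr hϖ.not_isUnit) n hn1)
  set C' : VariableChange (v.adicCompletion K) := D.baseChange (v.adicCompletion K) * C with hC'def
  have hC' : C' • W.baseChange (v.adicCompletion K) = J.baseChange (v.adicCompletion K) := by
    rw [hC'def, mul_smul, hCI, hJ]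
    exact LocalIndex.baseChange_smul_eq (K := v.adicCompletion K) I D
  haveI hJell : (J.baseChange (v.adicCompletion K)).IsElliptic := by rw [← hC']; infer_instance
  have hmapJ : (J.baseChange (v.adicCompletion K)).map
      (algebraMap (v.adicCompletion K) (AlgebraicClosure (v.adicCompletion K))) =
      (J.baseChange (v.adicCompletion K)).baseChange (AlgebraicClosure (v.adicCompletion K)) := rfl
  /- (2) the explicit transport `Φ : E(K̄_v) ≃+ J(K̄_v)` and `g : E(K_v) → J(K̄_v)` -/
  have hCM' := congrArg (fun Y : WeierstrassCurve (v.adicCompletion K) ↦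
    Y.baseChange (AlgebraicClosure (v.adicCompletion K))) hC'
  set Φ : localPoints W (v.adicCompletion K) ≃+
      ((J.baseChange (v.adicCompletion K)).baseChange (AlgebraicClosure (v.adicCompletion K))).toAffine.Point :=
    ((Affine.Point.congrEquiv (baseChange_baseChange_adicCompletion W v).symm).trans
      (VariableChange.pointEquivBaseChange (W.baseChange (v.adicCompletion K)) C'
        (AlgebraicClosure (v.adicCompletion K)))).trans (Affine.Point.congrEquiv hCM') with hΦdef
  have hΦ : ∀ (σ : absoluteGaloisGroup (v.adicCompletion K)) (Q : localPoints W (v.adicCompletion K)),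
      Φ (σ • Q) = Affine.Point.map ((absoluteGaloisGroup.toAlgEquiv _ σ :
          AlgebraicClosure (v.adicCompletion K) ≃ₐ[v.adicCompletion K]
            AlgebraicClosure (v.adicCompletion K)) :
          AlgebraicClosure (v.adicCompletion K) →ₐ[v.adicCompletion K]
            AlgebraicClosure (v.adicCompletion K)) (Φ Q) :=
    fun σ Q => transport_smul W v hC' σ Q
  set g : (W.baseChange (v.adicCompletion K)).toAffine.Point →+
      ((J.baseChange (v.adicCompletion K)).baseChange (AlgebraicClosure (v.adicCompletion K))).toAffine.Point :=
    Φ.toAddMonoidHom.comp ((W.baseChangeGeomPointsEquiv (v.adicCompletion K)).toAddMonoidHom.comp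
      (toGeomPoints (W.baseChange (v.adicCompletion K)))) with hg
  have hgapply : ∀ Q₀, g Q₀ = Φ (W.baseChangeGeomPointsEquiv (v.adicCompletion K)
      (toGeomPoints (W.baseChange (v.adicCompletion K)) Q₀)) := fun Q₀ => rfl
  have hgP : ∀ Q₀, g Q₀ = mapPoint (algebraMap (v.adicCompletion K) (AlgebraicClosure (v.adicCompletion K)))
      hmapJ (Affine.Point.congrEquiv hC' (VariableChange.pointEquiv (W.baseChange (v.adicCompletion K)) C' Q₀)) :=
    fun Q₀ => transport_toGeomPoints W v hC' hmapJ Q₀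
  have hgfix : ∀ Q₀ (σ : absoluteGaloisGroup (v.adicCompletion K)),
      Affine.Point.map ((absoluteGaloisGroup.toAlgEquiv _ σ :
          AlgebraicClosure (v.adicCompletion K) ≃ₐ[v.adicCompletion K]
            AlgebraicClosure (v.adicCompletion K)) :
          AlgebraicClosure (v.adicCompletion K) →ₐ[v.adicCompletion K]
            AlgebraicClosure (v.adicCompletion K)) (g Q₀) = g Q₀ := fun Q₀ σ => by
    rw [hgP]; exact map_toAlgEquiv_mapPoint _ hmapJ _ σ
  /- (3) `E₀ ⊆ J(K̄_v)` and `E₀' = g⁻¹(E₀) ≤ E(K_v)`; `E₀'` membership = nonsingular reduction on `I` -/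
  obtain ⟨W₀, hW₀, -⟩ := exists_integerModel_of_tateNormalForm hw J hJ1 hJ2 hJ3 hJ4 h6
  set E₀V := (W₀.nonsingularReductionSubgroup hv0).comap
    (Affine.Point.congrEquiv hW₀.symm).toAddMonoidHom with hE₀V
  have hE₀Vmem : ∀ Q, Q ∈ E₀V ↔ ReducesToNonsingular w (residue w.integer) Q := fun Q => by
    rw [hE₀V, AddSubgroup.mem_comap, AddEquiv.coe_toAddMonoidHom,
      WeierstrassCurve.mem_nonsingularReductionSubgroup_iff,
      ← reducesToNonsingular_iff_hasNonsingularReduction W₀, reducesToNonsingular_congrEquiv_iff _ hW₀.symm]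
  set E₀' : AddSubgroup (W.baseChange (v.adicCompletion K)).toAffine.Point := E₀V.comap g with hE₀'
  -- the two points of `J_{K_v} = (D • I)_{K_v}` obtained from `Q₀` agree
  have hpts : ∀ Q₀ : (W.baseChange (v.adicCompletion K)).toAffine.Point,
      Affine.Point.congrEquiv hC' (VariableChange.pointEquiv (W.baseChange (v.adicCompletion K)) C' Q₀) =
        Affine.Point.congrEquiv (LocalIndex.baseChange_smul_eq I D)
          (VariableChange.pointEquiv (I.baseChange (v.adicCompletion K))
            (D.map (algebraMap (v.adicCompletionIntegers K) (v.adicCompletion K)))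
            (Affine.Point.congrEquiv hCI (VariableChange.pointEquiv (W.baseChange (v.adicCompletion K)) C Q₀))) := by
    intro Q₀
    rcases Q₀ with _ | ⟨x, y, h⟩
    · change Affine.Point.congrEquiv hC' (VariableChange.pointEquiv (W.baseChange (v.adicCompletion K)) C' 0) =
        Affine.Point.congrEquiv (LocalIndex.baseChange_smul_eq I D)
          (VariableChange.pointEquiv (I.baseChange (v.adicCompletion K))
            (D.map (algebraMap (v.adicCompletionIntegers K) (v.adicCompletion K)))
            (Affine.Point.congrEquiv hCI (VariableChange.pointEquiv (W.baseChange (v.adicCompletion K)) C 0)))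
      simp only [map_zero]
    · rw [VariableChange.pointEquiv_some, Affine.Point.congrEquiv_some, VariableChange.pointEquiv_some,
        Affine.Point.congrEquiv_some, VariableChange.pointEquiv_some, Affine.Point.congrEquiv_some]
      exact point_some_congr (toX_mul _ _ x) (toY_mul _ _ x y)
  have hE₀'iff : ∀ Q₀, Q₀ ∈ E₀' ↔ I.HasNonsingularReduction
      (Affine.Point.congrEquiv hCI (VariableChange.pointEquiv (W.baseChange (v.adicCompletion K)) C Q₀)) := by
    intro Q₀
    rw [hE₀', AddSubgroup.mem_comap, hE₀Vmem, hgP,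
      reducesToNonsingular_mapPoint_iff_of_tateNormalForm hw J hJ1 hJ2 hJ3 hJ4 h6 hmapJ, hpts]
    exact LocalIndex.hasNonsingularReduction_pointEquiv_iff I D _
  /- (4) `E₀' ≤ A`: points of `E₀` have inertia-fixed `p`-th roots (PART IX §1) -/
  have hE₀'A : E₀' ≤ A := fun Q₀ hQ₀ => by
    rw [hE₀', AddSubgroup.mem_comap, hE₀Vmem] at hQ₀
    obtain ⟨S, -, hpS, hSfix⟩ :=
      exists_nsmul_eq_fixed_of_reducesToNonsingular_of_tateNormalForm hw J hJ1 hJ2 hJ3 hJ4 h6 hpp hpv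
        h𝔐 (g Q₀) (fun τ _ => hgfix Q₀ τ) hQ₀
    refine (hmemA Q₀).mpr ⟨Φ.symm S, Φ.injective ?_, fun τ hτ => Φ.injective ?_⟩
    · rw [map_zsmul, AddEquiv.apply_symm_apply, natCast_zsmul, hpS]
      exact hgapply Q₀
    · rw [hΦ, AddEquiv.apply_symm_apply]
      exact hSfix τ (by rw [inertia_eq_absInertia hw h𝔐]; exact hτ)
  /- (5) `A ≠ ⊤` (the Kodaira–Néron witness) -/
  have hAtop : A ≠ ⊤ := by
    obtain ⟨Q₁, hQ₁⟩ :=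
      exists_point_forall_absInertia_not_fixed_of_hasSplitMultiplicativeReductionAt_of_dvd W v hsplit
        (p := p) hn
    intro htop
    obtain ⟨Q, hQ, hfix⟩ := (hmemA Q₁).mp (htop ▸ AddSubgroup.mem_top Q₁)
    obtain ⟨τ, hτ, hne⟩ := hQ₁ Q hQ
    exact hne (hfix τ hτ)
  /- (6') the rational generator of `J(K_v^nr)/J₀ ≅ ℤ/n`; `B := E₀' ⊔ pE(K_v)` has index `p` -/
  obtain ⟨gV, hgVfix, hgVord, hgVgen⟩ :=
    exists_rational_generator_of_tateNormalForm hw h𝔐 J hϖ hJ1 hJ2 hJ3 hJ4 α.isUnit hn1 hJ6'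
  obtain ⟨Pstar, hPstar⟩ : ∃ Q₀, g Q₀ = gV := by
    have h1 : ∀ σ : absoluteGaloisGroup (v.adicCompletion K), σ • Φ.symm gV = Φ.symm gV :=
      fun σ => Φ.injective (by rw [hΦ, AddEquiv.apply_symm_apply, hgVfix])
    have h2 : ∀ σ : absoluteGaloisGroup (v.adicCompletion K),
        σ • (W.baseChangeGeomPointsEquiv (v.adicCompletion K)).symm (Φ.symm gV) =
          (W.baseChangeGeomPointsEquiv (v.adicCompletion K)).symm (Φ.symm gV) := fun σ =>
      (W.baseChangeGeomPointsEquiv (v.adicCompletion K)).injective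
        (by rw [W.baseChangeGeomPointsEquiv_smul, AddEquiv.apply_symm_apply, h1])
    obtain ⟨Q₀, hQ₀⟩ := exists_toGeomPoints_eq_of_forall_smul_eq
      (W := W.baseChange (v.adicCompletion K)) h2
    exact ⟨Q₀, by rw [hgapply, hQ₀, AddEquiv.apply_symm_apply, AddEquiv.apply_symm_apply]⟩
  have hgen : ∀ Q₀, ∃ i : ℕ, Q₀ - i • Pstar ∈ E₀' := fun Q₀ => by
    obtain ⟨i, -, hi⟩ := hgVgen (g Q₀) (fun τ _ => hgfix Q₀ τ)
    refine ⟨i, ?_⟩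
    rw [hE₀', AddSubgroup.mem_comap, map_sub, map_nsmul, hPstar, hE₀Vmem]
    exact hi
  have hord : ∀ i : ℕ, i • Pstar ∈ E₀' ↔ n ∣ i := fun i => by
    rw [hE₀', AddSubgroup.mem_comap, map_nsmul, hPstar, hE₀Vmem]
    exact hgVord i
  have hpn : p ∣ n := hn
  have hBidx := index_eq_of_generator E₀' Pstar hpn hgen hord
  set B := E₀' ⊔ (zsmulAddGroupHom (p : ℤ) :
    (W.baseChange (v.adicCompletion K)).toAffine.Point →+ _).range with hB
  -- `pE(K_v) ≤ A`: a `p`-multiple of a RATIONAL point has a Galois-fixed `p`-th root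
  have hpA : (zsmulAddGroupHom (p : ℤ) :
      (W.baseChange (v.adicCompletion K)).toAffine.Point →+ _).range ≤ A := by
    rintro _ ⟨Q₀, rfl⟩
    refine (hmemA _).mpr ⟨W.baseChangeGeomPointsEquiv (v.adicCompletion K)
      (toGeomPoints (W.baseChange (v.adicCompletion K)) Q₀), ?_, fun τ _ => ?_⟩
    · rw [show (zsmulAddGroupHom (p : ℤ) :
          (W.baseChange (v.adicCompletion K)).toAffine.Point →+ _) Q₀ = (p : ℤ) • Q₀ from rfl,
        map_zsmul, map_zsmul]
    · rw [← W.baseChangeGeomPointsEquiv_smul]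
      exact congrArg _ (MulAction.mem_fixedPoints.mp
        (toGeomPoints_mem_fixedPoints (W.baseChange (v.adicCompletion K)) Q₀) τ)
  have hBA : B ≤ A := sup_le hE₀'A hpA
  have hBidx' : B.index = p := hBidx
  /- (7') `A = B`: both have index `p`, `B ≤ A ≠ ⊤` -/
  have hAidx : A.index = p := by
    have hdvd : A.index ∣ p := hBidx' ▸ AddSubgroup.index_dvd_of_le hBA
    rcases (Nat.dvd_prime hpp).mp hdvd with h1 | h1
    · exact absurd (AddSubgroup.index_eq_one.mp h1) hAtop
    · exact h1
  have hAB : A = B := by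
    refine le_antisymm ?_ hBA
    have h := AddSubgroup.relIndex_mul_index hBA
    rw [hAidx, hBidx'] at h
    exact AddSubgroup.relIndex_eq_one.mp
      (Nat.eq_of_mul_eq_mul_right hpp.pos (h.trans (one_mul p).symm))
  /- (8) `Q₀ ∈ B ↔ (n / p) • Q₀ ∈ E₀'` (the cyclic group `E(K_v)/E₀' ≅ ℤ/n`) -/
  obtain ⟨k, hk⟩ := hpn
  have hkp : n / p = k := by rw [hk, Nat.mul_div_cancel_left _ hpp.pos]
  have hnE : ∀ R : (W.baseChange (v.adicCompletion K)).toAffine.Point, n • R ∈ E₀' := fun R => by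
    obtain ⟨i, hi⟩ := hgen R
    have h1 : n • R = n • (R - i • Pstar) + (n * i) • Pstar := by
      rw [mul_nsmul', nsmul_sub, sub_add_cancel]
    rw [h1]
    exact E₀'.add_mem (E₀'.nsmul_mem hi n) ((hord _).mpr (dvd_mul_right _ _))
  have hmemB : ∀ Q₀, Q₀ ∈ B ↔ (n / p) • Q₀ ∈ E₀' := fun Q₀ => by
    rw [hkp]
    constructor
    · intro hQ
      obtain ⟨e, he, z, ⟨R, rfl⟩, hsum⟩ := AddSubgroup.mem_sup.mp hQ
      rw [← hsum, nsmul_add]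
      refine E₀'.add_mem (E₀'.nsmul_mem he k) ?_
      have h1 : k • ((zsmulAddGroupHom (p : ℤ) :
          (W.baseChange (v.adicCompletion K)).toAffine.Point →+ _) R) = n • R := by
        change k • ((p : ℤ) • R) = n • R
        rw [natCast_zsmul, ← mul_nsmul', hk, mul_comm]
      rw [h1]
      exact hnE R
    · intro hQ
      obtain ⟨j, hj⟩ := hgen Q₀
      -- `(k j) • Pstar ∈ E₀'`, so `n ∣ k j`, so `p ∣ j`
      have h1 : (k * j) • Pstar ∈ E₀' := by
        have h2 : (k * j) • Pstar = k • Q₀ - k • (Q₀ - j • Pstar) := by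
          rw [mul_nsmul', nsmul_sub, sub_sub_cancel]
        rw [h2]
        exact E₀'.sub_mem hQ (E₀'.nsmul_mem hj k)
      have h3 : n ∣ k * j := (hord _).mp h1
      rw [hk, mul_comm p k] at h3
      obtain ⟨i, hi⟩ := Nat.dvd_of_mul_dvd_mul_left
        (Nat.pos_of_ne_zero fun h0 => (Nat.one_le_iff_ne_zero.mp hn1) (by rw [hk, h0, mul_zero])) h3
      refine AddSubgroup.mem_sup.mpr ⟨Q₀ - j • Pstar, hj, (p : ℤ) • (i • Pstar), ⟨i • Pstar, rfl⟩, ?_⟩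
      rw [hi, natCast_zsmul, ← mul_nsmul', sub_add_cancel]
  -- conclusion
  change P ∈ A ↔ _
  rw [hAB, hmemB]
  exact hE₀'iff _

end Summit.BirchSwinnertonDyer.Rank1Residual.X10.ResidualSelmerLocalRamificationDiv

end
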